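import Summits.Ventures.CertifiedManyBodySolver.Rows.DopedTLCorr
import HarnessLib

/-!
# The λ-FORM of a thermodynamic-limit correlator bound: an ENERGY certificate for the perturbed density
# `h₀ + λ·O` plus a certified cap `e₀ ≤ hi` is a correlator row for `O` (crew hubbard-obs, D-0042)

HONEST FRAMING: first certified bounds on pairing observables; not a superconductivity verdict; every
number certified (two lineages + referee) or labelled float. NOTHING IS ASSERTED HERE; theorem-only
(no definition, no named fact, no `sorry`); zero compute. Seat hubbard-obs-p1 (`prover-hubbard-obs-p1-g0-0`),
spec HOME/obs-p1/PAIRCORR-SDP.md §5; answers the lead's ruling (r)(iii) 2026-08-25 ("is the λ-form a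
corollary of an existing tree theorem?") — YES: of the CORRELATOR window theorem
`InfVolFermionState.IsTorusLimitOf.re_expect_ge_of_window_certificate_TT'_ineq`
(`HubbardNNNHoppingTorusLimitCorrelator`), NOT of the (Hubbard-specific) energy theorem.

The λ-form certificate produced by an ENERGY engine (symsdp / eqipm / leg J with the objective density
`h₀ + λ O`, eng-1 rung 0b-lite lineage A, FORMAT §6 'scan') is the window identity
  `λ•O + Γ(incl) E^{tt'}_Φ − E_cert•1 − Σ_σ μ_σ (n_{0σ} − ν•1) = SOS + [H, B] + defects + charged + (Vᴴ − V) + residual`,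
i.e. "`E_cert ≤ ω(h₀ + λO)` on the translation-invariant relaxation". It IS the tree's correlator identity
with objective word `Xw := λ•O`, energy multiplier `κ := 1` and cap slot `u := hi`, constant
`c := E_cert − hi` (`lambda_identity_eq_window_identity`: the two left-hand sides agree identically). Hence,
for every torus-limit ground state `ω` of the class with `energyDensityTT' 1 tp U n ≤ hi`:
  `E_cert − hi − Σ‖aₖ‖ + (Σμ)(n/2 − ν) ≤ λ · Re ω(O)`                     (`re_expect_mul_ge_of_lambda_certificate`),
so `λ > 0` gives the LOWER row `Re ω(O) ≥ (E_cert − hi − Σ‖a‖ + (Σμ)(n/2 − ν))/λ` and `λ < 0` the UPPER row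
`Re ω(O) ≤ (hi − E_cert + Σ‖a‖ − (Σμ)(n/2 − ν))/|λ|` — typed below as `SquareTTPrimeCorrLowerRow.of_lambda_certificate`
/ `SquareTTPrimeCorrUpperRow.of_lambda_certificate` (rational slots `hi`, `r`), M3′ wrappers. The `ge`
row (`lo`) cannot enter this one-multiplier form (it is the `κ₋ = 0` face of the two-row problem; see
`Rows/DopedTLCorrWindow.lean`). Reader-side this is a RELABELLING of the energy certificate (objective split
into `E_Φ` + `λ O`), no new arithmetic.
-/

noncomputable section

namespace Summit.Ventures.CertifiedManyBodySolver

open Literature.MathematicalPhysics.QuantumLattice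
open Matrix HubbardWave0 Literature.Probability.LatticeModels ThermodynamicLimit Filter Topology
open Literature.MathematicalPhysics.QuantumManyBody.StateRelaxation
open scoped ComplexOrder BigOperators

section Lambda

/-- **The λ-form identity IS the window identity** with `Xw = λ•O`, `κ = 1`, `u = hi`, `c = E_cert − hi`:
the left-hand sides agree in any `ℂ`-module (here `𝔄_{Λ'}`). -/
theorem lambda_identity_eq_window_identity {M : Type*} [AddCommGroup M] [Module ℂ M]
    (O E one D : M) (lam Ecert hi : ℝ) :
    ((lam : ℝ) : ℂ) • O - (((Ecert - hi : ℝ)) : ℂ) • one - D -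
        (((1 : ℝ)) : ℂ) • ((((hi : ℝ)) : ℂ) • one - E) =
      ((lam : ℝ) : ℂ) • O + E - ((Ecert : ℝ) : ℂ) • one - D := by
  push_cast
  module

/-- **λ-form certificate ⇒ `λ · Re ω(O)` is bounded below**, for every torus-limit ground state of the
`t–t'` class at density `n` with `energyDensityTT' 1 tp U n ≤ hi`. Data: the binders of
`IsTorusLimitOf.re_expect_ge_of_window_certificate_TT'_ineq` (translation-only, `γₗ = 1`) except that the
identity is written in the λ-form (objective `λ•O + Γ E_Φ`, constant `E_cert`, NO energy-cap term). -/
theorem re_expect_mul_ge_of_lambda_certificate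
    (tp : ℝ) {U : ℝ} (hU : 0 ≤ U) {n : ℝ} (hn0 : 0 ≤ n) (hn2 : n < 2) (lam : ℝ) {hi Ecert : ℝ}
    (hhi : energyDensityTT' 1 tp U n ≤ hi)
    {Λ Λ' : Finset (Site 2)} (hΛ : Λ ⊆ Λ') (h8 : thicken Λ 1 ⊆ Λ')
    (h0 : thicken ({0} : Finset (Site 2)) 1 ⊆ Λ') (hz : (0 : Site 2) ∈ Λ')
    (Ow : FermionOp Λ') (μ : Fin 2 → ℝ) (ν : ℝ)
    {m : Type*} [Fintype m] [DecidableEq m] {Λm : Matrix m m ℂ} (hΛm : Λm.PosSemidef)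
    (Og : m → FermionOp Λ')
    {κ' : Type*} (s : Finset κ') (B : κ' → FermionOp Λ)
    {ι : Type*} (tt : Finset ι) (γ : ι → DihedralGroup 4) (hγ1 : ∀ l ∈ tt, γ l = 1) (wv : ι → Site 2)
    (hsh : ∀ l, d4ShiftSet (γ l) (wv l) Λ ⊆ Λ') (Y : ι → FermionOp Λ)
    {ρ : Type*} (uu : Finset ρ) (b : ρ → ℂ) (cw : ρ → List (Orb (PolySite Λ') × Bool))
    (hcw : ∀ j ∈ uu, ladderCharge (cw j) ≠ 0 ∨ ladderSpinCharge (cw j) ≠ 0)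
    {δ : Type*} (ah : Finset δ) (dc : δ → ℝ) (V : δ → FermionOp Λ')
    {κ'' : Type*} (w : Finset κ'') (a : κ'' → ℂ) (word : κ'' → List (Orb (PolySite Λ') × Bool))
    (hcert : ((lam : ℝ) : ℂ) • Ow +
        fermionEmbed (PolySite.incl h0) ((hubbardTTPrimeFermionInteraction 1 tp U).meanEnergyObs 1) -
        ((Ecert : ℝ) : ℂ) • (1 : FermionOp Λ') -
        ∑ σ : Fin 2, ((μ σ : ℝ) : ℂ) • (nAt 0 hz σ - ((ν : ℝ) : ℂ) • (1 : FermionOp Λ')) =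
      gramForm Λm Og +
        (∑ k ∈ s, ((hubbardTTPrimeFermionInteraction 1 tp U).localHamiltonian Λ' *
              fermionEmbed (PolySite.incl hΛ) (B k) -
            fermionEmbed (PolySite.incl hΛ) (B k) * (hubbardTTPrimeFermionInteraction 1 tp U).localHamiltonian Λ') +
          ∑ l ∈ tt, (fermionEmbed (PolySite.incl (hsh l)) (fermionEmbed (PolySite.d4Emb (γ l) (wv l) Λ) (Y l)) -
            fermionEmbed (PolySite.incl hΛ) (Y l)) +
          ∑ j ∈ uu, b j • ladderWord (cw j)) +
        (∑ m' ∈ ah, ((dc m' : ℝ) : ℂ) • ((V m')ᴴ - V m') + ∑ k ∈ w, a k • ladderWord (word k)))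
    {Ls : ℕ → ℕ} (hLs : Tendsto Ls atTop atTop)
    {ψ : ∀ L, Fock (Orb (FermionTorus 2 L))}
    (hψ : ∀ j, IsGroundStateInSector (hubbardTorusTT' (Ls j) 1 tp U) (rectN n (Ls j)) 0 (ψ (Ls j)))
    (hψ1 : ∀ j, star (ψ (Ls j)) ⬝ᵥ ψ (Ls j) = 1)
    {ω : InfVolFermionState 2} (hω : ω.IsTorusLimitOf ψ Ls) :
    Ecert - hi - ∑ k ∈ w, ‖a k‖ + (∑ σ : Fin 2, μ σ) * (n / 2 - ν) ≤ lam * (ω.expect Λ' Ow).re := by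
  -- rewrite the λ-form identity as the window identity with `Xw = λ•O`, `κ = 1`, `u = hi`, `c = E_cert − hi`
  have hcert' : ((lam : ℝ) : ℂ) • Ow - (((Ecert - hi : ℝ)) : ℂ) • (1 : FermionOp Λ') -
      ∑ σ : Fin 2, ((μ σ : ℝ) : ℂ) • (nAt 0 hz σ - ((ν : ℝ) : ℂ) • (1 : FermionOp Λ')) -
      (((1 : ℝ)) : ℂ) • ((((hi : ℝ)) : ℂ) • (1 : FermionOp Λ') -
        fermionEmbed (PolySite.incl h0) ((hubbardTTPrimeFermionInteraction 1 tp U).meanEnergyObs 1)) =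
      gramForm Λm Og +
        (∑ k ∈ s, ((hubbardTTPrimeFermionInteraction 1 tp U).localHamiltonian Λ' *
              fermionEmbed (PolySite.incl hΛ) (B k) -
            fermionEmbed (PolySite.incl hΛ) (B k) * (hubbardTTPrimeFermionInteraction 1 tp U).localHamiltonian Λ') +
          ∑ l ∈ tt, (fermionEmbed (PolySite.incl (hsh l)) (fermionEmbed (PolySite.d4Emb (γ l) (wv l) Λ) (Y l)) -
            fermionEmbed (PolySite.incl hΛ) (Y l)) +
          ∑ j ∈ uu, b j • ladderWord (cw j)) +
        (∑ m' ∈ ah, ((dc m' : ℝ) : ℂ) • ((V m')ᴴ - V m') + ∑ k ∈ w, a k • ladderWord (word k)) := by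
    rw [lambda_identity_eq_window_identity]
    exact hcert
  have h := hω.re_expect_ge_of_window_certificate_TT'_ineq 1 tp hU hn0 hn2 (κ := 1) (u := hi) zero_le_one hhi
    hΛ h8 h0 hz (((lam : ℝ) : ℂ) • Ow) μ ν hΛm Og s B tt γ hγ1 wv hsh Y uu b cw hcw ah dc V w a word hcert' hLs hψ hψ1
  rw [map_smul, smul_eq_mul, Complex.re_ofReal_mul] at h
  linarith

/-- **λ > 0: an energy certificate for `h₀ + λO` is a LOWER row for `O`.** With the λ-form data of
`re_expect_mul_ge_of_lambda_certificate` at a rational cap slot `hi` and `λ > 0`, any rational `r` with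
`r ≤ (E_cert − hi − Σ‖aₖ‖ + (Σμ)(n/2 − ν))/λ` gives `SquareTTPrimeCorrLowerRow tp U n hi r Λ' O`
(PAIRCORR-SDP.md §5: `Re ω(O) ≥ (e^lo(h + λO) − hi)/λ`). -/
theorem SquareTTPrimeCorrLowerRow.of_lambda_certificate
    (tp : ℝ) {U : ℝ} (hU : 0 ≤ U) {n : ℝ} (hn0 : 0 ≤ n) (hn2 : n < 2) {lam : ℝ} (hlam : 0 < lam)
    {hi r : ℚ} {Ecert : ℝ}
    {Λ Λ' : Finset (Site 2)} (hΛ : Λ ⊆ Λ') (h8 : thicken Λ 1 ⊆ Λ')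
    (h0 : thicken ({0} : Finset (Site 2)) 1 ⊆ Λ') (hz : (0 : Site 2) ∈ Λ')
    (Ow : FermionOp Λ') (μ : Fin 2 → ℝ) (ν : ℝ)
    {m : Type*} [Fintype m] [DecidableEq m] {Λm : Matrix m m ℂ} (hΛm : Λm.PosSemidef)
    (Og : m → FermionOp Λ')
    {κ' : Type*} (s : Finset κ') (B : κ' → FermionOp Λ)
    {ι : Type*} (tt : Finset ι) (γ : ι → DihedralGroup 4) (hγ1 : ∀ l ∈ tt, γ l = 1) (wv : ι → Site 2)
    (hsh : ∀ l, d4ShiftSet (γ l) (wv l) Λ ⊆ Λ') (Y : ι → FermionOp Λ)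
    {ρ : Type*} (uu : Finset ρ) (b : ρ → ℂ) (cw : ρ → List (Orb (PolySite Λ') × Bool))
    (hcw : ∀ j ∈ uu, ladderCharge (cw j) ≠ 0 ∨ ladderSpinCharge (cw j) ≠ 0)
    {δ : Type*} (ah : Finset δ) (dc : δ → ℝ) (V : δ → FermionOp Λ')
    {κ'' : Type*} (w : Finset κ'') (a : κ'' → ℂ) (word : κ'' → List (Orb (PolySite Λ') × Bool))
    (hcert : ((lam : ℝ) : ℂ) • Ow +
        fermionEmbed (PolySite.incl h0) ((hubbardTTPrimeFermionInteraction 1 tp U).meanEnergyObs 1) -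
        ((Ecert : ℝ) : ℂ) • (1 : FermionOp Λ') -
        ∑ σ : Fin 2, ((μ σ : ℝ) : ℂ) • (nAt 0 hz σ - ((ν : ℝ) : ℂ) • (1 : FermionOp Λ')) =
      gramForm Λm Og +
        (∑ k ∈ s, ((hubbardTTPrimeFermionInteraction 1 tp U).localHamiltonian Λ' *
              fermionEmbed (PolySite.incl hΛ) (B k) -
            fermionEmbed (PolySite.incl hΛ) (B k) * (hubbardTTPrimeFermionInteraction 1 tp U).localHamiltonian Λ') +
          ∑ l ∈ tt, (fermionEmbed (PolySite.incl (hsh l)) (fermionEmbed (PolySite.d4Emb (γ l) (wv l) Λ) (Y l)) -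
            fermionEmbed (PolySite.incl hΛ) (Y l)) +
          ∑ j ∈ uu, b j • ladderWord (cw j)) +
        (∑ m' ∈ ah, ((dc m' : ℝ) : ℂ) • ((V m')ᴴ - V m') + ∑ k ∈ w, a k • ladderWord (word k)))
    (hr : ((r : ℚ) : ℝ) ≤ (Ecert - hi - ∑ k ∈ w, ‖a k‖ + (∑ σ : Fin 2, μ σ) * (n / 2 - ν)) / lam) :
    SquareTTPrimeCorrLowerRow tp U n hi r Λ' Ow := by
  intro ω Ls ψ hLs hψ hψ1 hω hhi
  have h := re_expect_mul_ge_of_lambda_certificate tp hU hn0 hn2 lam hhi hΛ h8 h0 hz Ow μ ν hΛm Og s B tt γ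
    hγ1 wv hsh Y uu b cw hcw ah dc V w a word hcert hLs hψ hψ1 hω
  refine hr.trans ?_
  rw [div_le_iff₀ hlam]
  linarith

/-- **λ < 0: an energy certificate for `h₀ + λO = h₀ − |λ|O` is an UPPER row for `O`.** With `λ < 0`, any
rational `r` with `(hi − E_cert + Σ‖aₖ‖ − (Σμ)(n/2 − ν))/(−λ) ≤ r` gives `SquareTTPrimeCorrUpperRow tp U n hi r Λ' O`
(PAIRCORR-SDP.md §5: `Re ω(O) ≤ (hi − e^lo(h − |λ|O))/|λ|`). -/
theorem SquareTTPrimeCorrUpperRow.of_lambda_certificate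
    (tp : ℝ) {U : ℝ} (hU : 0 ≤ U) {n : ℝ} (hn0 : 0 ≤ n) (hn2 : n < 2) {lam : ℝ} (hlam : lam < 0)
    {hi r : ℚ} {Ecert : ℝ}
    {Λ Λ' : Finset (Site 2)} (hΛ : Λ ⊆ Λ') (h8 : thicken Λ 1 ⊆ Λ')
    (h0 : thicken ({0} : Finset (Site 2)) 1 ⊆ Λ') (hz : (0 : Site 2) ∈ Λ')
    (Ow : FermionOp Λ') (μ : Fin 2 → ℝ) (ν : ℝ)
    {m : Type*} [Fintype m] [DecidableEq m] {Λm : Matrix m m ℂ} (hΛm : Λm.PosSemidef)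
    (Og : m → FermionOp Λ')
    {κ' : Type*} (s : Finset κ') (B : κ' → FermionOp Λ)
    {ι : Type*} (tt : Finset ι) (γ : ι → DihedralGroup 4) (hγ1 : ∀ l ∈ tt, γ l = 1) (wv : ι → Site 2)
    (hsh : ∀ l, d4ShiftSet (γ l) (wv l) Λ ⊆ Λ') (Y : ι → FermionOp Λ)
    {ρ : Type*} (uu : Finset ρ) (b : ρ → ℂ) (cw : ρ → List (Orb (PolySite Λ') × Bool))
    (hcw : ∀ j ∈ uu, ladderCharge (cw j) ≠ 0 ∨ ladderSpinCharge (cw j) ≠ 0)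
    {δ : Type*} (ah : Finset δ) (dc : δ → ℝ) (V : δ → FermionOp Λ')
    {κ'' : Type*} (w : Finset κ'') (a : κ'' → ℂ) (word : κ'' → List (Orb (PolySite Λ') × Bool))
    (hcert : ((lam : ℝ) : ℂ) • Ow +
        fermionEmbed (PolySite.incl h0) ((hubbardTTPrimeFermionInteraction 1 tp U).meanEnergyObs 1) -
        ((Ecert : ℝ) : ℂ) • (1 : FermionOp Λ') -
        ∑ σ : Fin 2, ((μ σ : ℝ) : ℂ) • (nAt 0 hz σ - ((ν : ℝ) : ℂ) • (1 : FermionOp Λ')) =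
      gramForm Λm Og +
        (∑ k ∈ s, ((hubbardTTPrimeFermionInteraction 1 tp U).localHamiltonian Λ' *
              fermionEmbed (PolySite.incl hΛ) (B k) -
            fermionEmbed (PolySite.incl hΛ) (B k) * (hubbardTTPrimeFermionInteraction 1 tp U).localHamiltonian Λ') +
          ∑ l ∈ tt, (fermionEmbed (PolySite.incl (hsh l)) (fermionEmbed (PolySite.d4Emb (γ l) (wv l) Λ) (Y l)) -
            fermionEmbed (PolySite.incl hΛ) (Y l)) +
          ∑ j ∈ uu, b j • ladderWord (cw j)) +
        (∑ m' ∈ ah, ((dc m' : ℝ) : ℂ) • ((V m')ᴴ - V m') + ∑ k ∈ w, a k • ladderWord (word k)))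
    (hr : (hi - Ecert + ∑ k ∈ w, ‖a k‖ - (∑ σ : Fin 2, μ σ) * (n / 2 - ν)) / (-lam) ≤ ((r : ℚ) : ℝ)) :
    SquareTTPrimeCorrUpperRow tp U n hi r Λ' Ow := by
  intro ω Ls ψ hLs hψ hψ1 hω hhi
  have h := re_expect_mul_ge_of_lambda_certificate tp hU hn0 hn2 lam hhi hΛ h8 h0 hz Ow μ ν hΛm Og s B tt γ
    hγ1 wv hsh Y uu b cw hcw ah dc V w a word hcert hLs hψ hψ1 hω
  refine le_trans ?_ hr
  have hneg : 0 < -lam := neg_pos.2 hlam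
  rw [le_div_iff₀ hneg]
  linarith

/-- M3′ wrapper (`U = 8`, `n = 7/8`), `λ > 0`: the λ-form energy certificate is an `M3CorrLowerRow tp hi r Λ' O`. -/
theorem M3CorrLowerRow.of_lambda_certificate
    (tp : ℝ) {lam : ℝ} (hlam : 0 < lam) {hi r : ℚ} {Ecert : ℝ}
    {Λ Λ' : Finset (Site 2)} (hΛ : Λ ⊆ Λ') (h8 : thicken Λ 1 ⊆ Λ')
    (h0 : thicken ({0} : Finset (Site 2)) 1 ⊆ Λ') (hz : (0 : Site 2) ∈ Λ')
    (Ow : FermionOp Λ') (μ : Fin 2 → ℝ) (ν : ℝ)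
    {m : Type*} [Fintype m] [DecidableEq m] {Λm : Matrix m m ℂ} (hΛm : Λm.PosSemidef)
    (Og : m → FermionOp Λ')
    {κ' : Type*} (s : Finset κ') (B : κ' → FermionOp Λ)
    {ι : Type*} (tt : Finset ι) (γ : ι → DihedralGroup 4) (hγ1 : ∀ l ∈ tt, γ l = 1) (wv : ι → Site 2)
    (hsh : ∀ l, d4ShiftSet (γ l) (wv l) Λ ⊆ Λ') (Y : ι → FermionOp Λ)
    {ρ : Type*} (uu : Finset ρ) (b : ρ → ℂ) (cw : ρ → List (Orb (PolySite Λ') × Bool))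
    (hcw : ∀ j ∈ uu, ladderCharge (cw j) ≠ 0 ∨ ladderSpinCharge (cw j) ≠ 0)
    {δ : Type*} (ah : Finset δ) (dc : δ → ℝ) (V : δ → FermionOp Λ')
    {κ'' : Type*} (w : Finset κ'') (a : κ'' → ℂ) (word : κ'' → List (Orb (PolySite Λ') × Bool))
    (hcert : ((lam : ℝ) : ℂ) • Ow +
        fermionEmbed (PolySite.incl h0) ((hubbardTTPrimeFermionInteraction 1 tp 8).meanEnergyObs 1) -
        ((Ecert : ℝ) : ℂ) • (1 : FermionOp Λ') -
        ∑ σ : Fin 2, ((μ σ : ℝ) : ℂ) • (nAt 0 hz σ - ((ν : ℝ) : ℂ) • (1 : FermionOp Λ')) =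
      gramForm Λm Og +
        (∑ k ∈ s, ((hubbardTTPrimeFermionInteraction 1 tp 8).localHamiltonian Λ' *
              fermionEmbed (PolySite.incl hΛ) (B k) -
            fermionEmbed (PolySite.incl hΛ) (B k) * (hubbardTTPrimeFermionInteraction 1 tp 8).localHamiltonian Λ') +
          ∑ l ∈ tt, (fermionEmbed (PolySite.incl (hsh l)) (fermionEmbed (PolySite.d4Emb (γ l) (wv l) Λ) (Y l)) -
            fermionEmbed (PolySite.incl hΛ) (Y l)) +
          ∑ j ∈ uu, b j • ladderWord (cw j)) +
        (∑ m' ∈ ah, ((dc m' : ℝ) : ℂ) • ((V m')ᴴ - V m') + ∑ k ∈ w, a k • ladderWord (word k)))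
    (hr : ((r : ℚ) : ℝ) ≤ (Ecert - hi - ∑ k ∈ w, ‖a k‖ + (∑ σ : Fin 2, μ σ) * ((7 / 8 : ℝ) / 2 - ν)) / lam) :
    M3CorrLowerRow tp hi r Λ' Ow :=
  SquareTTPrimeCorrLowerRow.of_lambda_certificate tp (by norm_num) (by norm_num) (by norm_num) hlam hΛ h8 h0 hz
    Ow μ ν hΛm Og s B tt γ hγ1 wv hsh Y uu b cw hcw ah dc V w a word hcert hr

/-- M3′ wrapper, `λ < 0`: the λ-form energy certificate is an `M3CorrUpperRow tp hi r Λ' O`. -/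
theorem M3CorrUpperRow.of_lambda_certificate
    (tp : ℝ) {lam : ℝ} (hlam : lam < 0) {hi r : ℚ} {Ecert : ℝ}
    {Λ Λ' : Finset (Site 2)} (hΛ : Λ ⊆ Λ') (h8 : thicken Λ 1 ⊆ Λ')
    (h0 : thicken ({0} : Finset (Site 2)) 1 ⊆ Λ') (hz : (0 : Site 2) ∈ Λ')
    (Ow : FermionOp Λ') (μ : Fin 2 → ℝ) (ν : ℝ)
    {m : Type*} [Fintype m] [DecidableEq m] {Λm : Matrix m m ℂ} (hΛm : Λm.PosSemidef)
    (Og : m → FermionOp Λ')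
    {κ' : Type*} (s : Finset κ') (B : κ' → FermionOp Λ)
    {ι : Type*} (tt : Finset ι) (γ : ι → DihedralGroup 4) (hγ1 : ∀ l ∈ tt, γ l = 1) (wv : ι → Site 2)
    (hsh : ∀ l, d4ShiftSet (γ l) (wv l) Λ ⊆ Λ') (Y : ι → FermionOp Λ)
    {ρ : Type*} (uu : Finset ρ) (b : ρ → ℂ) (cw : ρ → List (Orb (PolySite Λ') × Bool))
    (hcw : ∀ j ∈ uu, ladderCharge (cw j) ≠ 0 ∨ ladderSpinCharge (cw j) ≠ 0)
    {δ : Type*} (ah : Finset δ) (dc : δ → ℝ) (V : δ → FermionOp Λ')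
    {κ'' : Type*} (w : Finset κ'') (a : κ'' → ℂ) (word : κ'' → List (Orb (PolySite Λ') × Bool))
    (hcert : ((lam : ℝ) : ℂ) • Ow +
        fermionEmbed (PolySite.incl h0) ((hubbardTTPrimeFermionInteraction 1 tp 8).meanEnergyObs 1) -
        ((Ecert : ℝ) : ℂ) • (1 : FermionOp Λ') -
        ∑ σ : Fin 2, ((μ σ : ℝ) : ℂ) • (nAt 0 hz σ - ((ν : ℝ) : ℂ) • (1 : FermionOp Λ')) =
      gramForm Λm Og +
        (∑ k ∈ s, ((hubbardTTPrimeFermionInteraction 1 tp 8).localHamiltonian Λ' *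
              fermionEmbed (PolySite.incl hΛ) (B k) -
            fermionEmbed (PolySite.incl hΛ) (B k) * (hubbardTTPrimeFermionInteraction 1 tp 8).localHamiltonian Λ') +
          ∑ l ∈ tt, (fermionEmbed (PolySite.incl (hsh l)) (fermionEmbed (PolySite.d4Emb (γ l) (wv l) Λ) (Y l)) -
            fermionEmbed (PolySite.incl hΛ) (Y l)) +
          ∑ j ∈ uu, b j • ladderWord (cw j)) +
        (∑ m' ∈ ah, ((dc m' : ℝ) : ℂ) • ((V m')ᴴ - V m') + ∑ k ∈ w, a k • ladderWord (word k)))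
    (hr : (hi - Ecert + ∑ k ∈ w, ‖a k‖ - (∑ σ : Fin 2, μ σ) * ((7 / 8 : ℝ) / 2 - ν)) / (-lam) ≤ ((r : ℚ) : ℝ)) :
    M3CorrUpperRow tp hi r Λ' Ow :=
  SquareTTPrimeCorrUpperRow.of_lambda_certificate tp (by norm_num) (by norm_num) (by norm_num) hlam hΛ h8 h0 hz
    Ow μ ν hΛm Og s B tt γ hγ1 wv hsh Y uu b cw hcw ah dc V w a word hcert hr

end Lambda

end Summit.Ventures.CertifiedManyBodySolver

end
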